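import Mathlib
import HarnessLib
import Summits.ValiantsHypothesis.ValiantsHypothesis.Theorems.MonotoneRestorationOrbitRestorationLinearVolumeQPAdmissiblePatternVH

/-!
# The bounded-multiplicity rung decides the summit too: SIMPLE bipartite patterns with `≤ n` rows, columns and edges

Route MonotoneRestoration, aside R1 = `OrbitRestorationLinearVolumeQP` (stmt-ValiantsHypothesis-18294).  The item's informal
statement lists "bounded edge-multiplicity" as a sub-rung.  On `0/1` adjacency matrices parallel edges of a pattern are
invisible (`x² = x`), so the separating family of `…LinearVolumeQPAdmissiblePatternVH.lean` may be replaced by its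
SIMPLE version (`Multiset.dedup`), keeping `VNP`-membership and the separation:

* `eval_indicator_homPoly_dedup` — at a `0/1` point, `hom_{F}` and `hom_{simple(F)}` take the same value;
* `exists_separating_simple_vnp_family` — unconditionally, a family of SIMPLE bipartite patterns (`(E n).Nodup`) with
  `≤ n` rows, `≤ n` columns, `≤ n` edges whose hom polynomials are a `VNP` family and polylog-separating;
* `valiantsHypothesis_of_simplePatternOrbitRestoration` — **if every `VP` family of hom polynomials of single SIMPLE
  bipartite patterns with `≤ n` rows, columns and edges has square-symmetric circuits of quasi-polynomial orbit size, then
  `VP ≠ VNP` over `ℂ`** (multiplicity one, dimension one, volume `≤ 2n`, `≤ n` edges: the sparsest candidate crux below R1);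
* `not_simplePatternOrbitRestoration_vnp` — its `VNP` version is false.

Honest framing: implication/tightness; the candidate crux, R1, the crux and VP ≠ VNP remain open.
-/

noncomputable section

-- `Summit.ValiantsHypothesis.ValiantsHypothesis.…` is the tree's single-conjunct layout (Sub = Summit).
set_option linter.dupNamespace false

namespace Summit.ValiantsHypothesis.ValiantsHypothesis.Theorems

namespace OrbitRestorationLinearVolumeQPVHStrength

open MvPolynomial
open Summit.ValiantsHypothesis.ValiantsHypothesis.Theses.MonotoneRestoration
open Literature.Computability.AlgebraicComplexity
open Literature.ModelTheory.FiniteModelTheory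

/-- A product of `0/1` values over a multiset is `1` if all factors are `1` and `0` otherwise. [folklore] -/
theorem multiset_prod_map_zero_one {ι : Type*} (s : Multiset ι) (f : ι → ℂ) (hf : ∀ x ∈ s, f x = 0 ∨ f x = 1) :
    (s.map f).prod = if ∀ x ∈ s, f x = 1 then 1 else 0 := by
  classical
  split_ifs with h
  · exact Multiset.prod_eq_one (by
      intro y hy
      obtain ⟨x, hx, rfl⟩ := Multiset.mem_map.1 hy
      exact h x hx)
  · push Not at h
    obtain ⟨x, hx, hx1⟩ := h
    have hx0 : f x = 0 := (hf x hx).resolve_right hx1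
    exact Multiset.prod_eq_zero (Multiset.mem_map.2 ⟨x, hx, hx0⟩)

/-- Hence such a product does not see multiplicities: it agrees with the product over `dedup`. [folklore] -/
theorem multiset_prod_map_dedup_of_zero_one {ι : Type*} [DecidableEq ι] (s : Multiset ι) (f : ι → ℂ)
    (hf : ∀ x ∈ s, f x = 0 ∨ f x = 1) :
    (s.dedup.map f).prod = (s.map f).prod := by
  rw [multiset_prod_map_zero_one s f hf,
    multiset_prod_map_zero_one s.dedup f fun x hx => hf x (Multiset.mem_dedup.1 hx)]
  simp only [Multiset.mem_dedup]

/-- **Parallel edges are invisible on `0/1` matrices**: at an indicator point, the hom polynomial of a bipartite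
multigraph pattern and that of its underlying SIMPLE pattern (`dedup`) take the same value. [folklore] -/
theorem eval_indicator_homPoly_dedup {a b m : ℕ} (E : Multiset (Fin a × Fin b)) (S : Set (Fin m × Fin m)) :
    eval (S.indicator 1) (homPoly E.dedup m ℂ) = eval (S.indicator 1) (homPoly E m ℂ) := by
  classical
  unfold homPoly
  rw [map_sum, map_sum]
  refine Finset.sum_congr rfl fun h _ => ?_
  rw [map_multiset_prod, map_multiset_prod, Multiset.map_map, Multiset.map_map]
  refine multiset_prod_map_dedup_of_zero_one E _ fun e _ => ?_
  simp only [Function.comp_apply, eval_X, Set.indicator_apply, Pi.one_apply]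
  by_cases hS : (h.1 e.1, h.2 e.2) ∈ S <;> simp [hS]

/-- **An unconditional polylog-separating `VNP` family of single SIMPLE patterns of admissible size** (`≤ n` rows,
columns, edges; no parallel edges). [cite: DawarWilsenach2025, Thm 7.2; DwivediPagoSeppelt2026, §4] -/
theorem exists_separating_simple_vnp_family :
    ∃ (a b : ℕ → ℕ) (E : (n : ℕ) → Multiset (Fin (a n) × Fin (b n))),
      (∀ n, a n ≤ n) ∧ (∀ n, b n ≤ n) ∧ (∀ n, Multiset.card (E n) ≤ n) ∧ (∀ n, (E n).Nodup) ∧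
      IsVNPFamily (fun n => homPoly (E n) n ℂ) ∧
      ∀ c' N : ℕ, ∃ n : ℕ, N ≤ n ∧ ∃ X' Y' : SimpleGraph (Fin n),
        CkEquiv ((Nat.log 2 n + c') ^ c') X' Y' ∧
          eval (Set.indicator {ij : Fin n × Fin n | X'.Adj ij.1 ij.2} 1) (homPoly (E n) n ℂ) ≠
            eval (Set.indicator {ij : Fin n × Fin n | Y'.Adj ij.1 ij.2} 1) (homPoly (E n) n ℂ) := by
  classical
  obtain ⟨a, b, E, ha, hb, hE, -, hsep⟩ := exists_separating_admissible_vnp_family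
  have hcard : ∀ n, Multiset.card (E n).dedup ≤ n := fun n =>
    (Multiset.card_le_card (Multiset.dedup_le (E n))).trans (hE n)
  refine ⟨a, b, fun n => (E n).dedup, ha, hb, hcard, fun n => Multiset.nodup_dedup _, ?_, fun c' N => ?_⟩
  · exact HomPolyVNP.isVNPFamily_homPoly ℂ a b (fun n => (E n).dedup) 1
      (fun n => (ha n).trans (by rw [pow_one]; omega)) (fun n => (hb n).trans (by rw [pow_one]; omega))
      (fun n => (hcard n).trans (by rw [pow_one]; omega))
  · obtain ⟨n, hn, X', Y', hXY, hne⟩ := hsep c' N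
    refine ⟨n, hn, X', Y', hXY, ?_⟩
    rw [eval_indicator_homPoly_dedup, eval_indicator_homPoly_dedup]
    exact hne

/-- **The simple-pattern rung decides the summit.**  If every `VP` family of homomorphism polynomials of single SIMPLE
bipartite patterns with at most `n` rows, `n` columns and `n` edges has square-symmetric circuits of orbit size
`≤ 2^((log₂ n + c)^c)`, then `VP ≠ VNP` over `ℂ`. [cite: DawarWilsenach2025, Thm 7.2, Thm 5.1, §6, §7.1; DwivediPagoSeppelt2026, Outlook Q3] -/
theorem valiantsHypothesis_of_simplePatternOrbitRestoration
    (h : ∀ (a b : ℕ → ℕ) (E : (n : ℕ) → Multiset (Fin (a n) × Fin (b n))),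
      (∀ n, a n ≤ n) → (∀ n, b n ≤ n) → (∀ n, Multiset.card (E n) ≤ n) → (∀ n, (E n).Nodup) →
      IsVPFamily (fun n => homPoly (E n) n ℂ) →
      ∃ c : ℕ, ∀ n : ℕ, ∃ (G : Type) (_ : Fintype G) (C : LabelledArithCircuit ℂ (Fin n × Fin n) Unit G),
        C.IsSymmetric (Equiv.Perm (Fin n)) ∧ C.eval (C.output ()) = homPoly (E n) n ℂ ∧
          C.orbitSize (Equiv.Perm (Fin n)) ≤ 2 ^ ((Nat.log 2 n + c) ^ c)) :
    ValiantsHypothesis := by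
  show VP ℂ ≠ VNP ℂ
  intro hEq
  obtain ⟨a, b, E, ha, hb, hE, hnd, hVNP, hsep⟩ := exists_separating_simple_vnp_family
  exact not_qpOrbitSymmetric_of_polylogSeparating (fun n => homPoly (E n) n ℂ) hsep
    (h a b E ha hb hE hnd (isVPFamily_of_isVNPFamily_of_VP_eq_VNP hEq hVNP))

/-- **The `VNP` version of the simple-pattern rung is FALSE.** [cite: DawarWilsenach2025, Thm 7.2] -/
theorem not_simplePatternOrbitRestoration_vnp :
    ¬ ∀ (a b : ℕ → ℕ) (E : (n : ℕ) → Multiset (Fin (a n) × Fin (b n))),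
      (∀ n, a n ≤ n) → (∀ n, b n ≤ n) → (∀ n, Multiset.card (E n) ≤ n) → (∀ n, (E n).Nodup) →
      IsVNPFamily (fun n => homPoly (E n) n ℂ) →
      ∃ c : ℕ, ∀ n : ℕ, ∃ (G : Type) (_ : Fintype G) (C : LabelledArithCircuit ℂ (Fin n × Fin n) Unit G),
        C.IsSymmetric (Equiv.Perm (Fin n)) ∧ C.eval (C.output ()) = homPoly (E n) n ℂ ∧
          C.orbitSize (Equiv.Perm (Fin n)) ≤ 2 ^ ((Nat.log 2 n + c) ^ c) := by
  intro h
  obtain ⟨a, b, E, ha, hb, hE, hnd, hVNP, hsep⟩ := exists_separating_simple_vnp_family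
  exact not_qpOrbitSymmetric_of_polylogSeparating (fun n => homPoly (E n) n ℂ) hsep (h a b E ha hb hE hnd hVNP)

end OrbitRestorationLinearVolumeQPVHStrength

end Summit.ValiantsHypothesis.ValiantsHypothesis.Theorems

end
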